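import Mathlib.Algebra.Field.ZMod
import Literature.Computability.AlgebraicComplexity.FlipGraphMoves
import HarnessLib

/-!
# Kauers–Moosbauer's flip-isolated rank-8 scheme for `⟨2,2,2⟩` over `ℤ₂` (KM 2023, §4)

Topic `Literature/Computability/AlgebraicComplexity`; companion of `FlipGraphMoves.lean` (KM Def. 2
= `FlipGraph.Reducible`, Def. 4 flips) in the tree's coordinates (`matMulTensor K k m n`,
`triad w u v`), kernel-checked.
Source: M. Kauers, J. Moosbauer, *Flip Graphs for Matrix Multiplication*, ISSAC 2023 =
arXiv:2212.01175 (KM), §4 ("The `(2,2,2)`-flip graph of rank at most 8 for `K = ℤ₂`"). KM print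
(the display following "we only found exactly one solution (up to symmetries) that does not belong
to this component"):
`M_{2,2,2} = (a₁₁+a₂₂)⊗(b₁₁+b₂₂)⊗c₂₁ + a₂₂⊗(b₁₁+b₂₁)⊗(c₁₂+c₂₁+c₂₂) + (a₂₁+a₂₂)⊗b₁₁⊗(c₁₂+c₂₂)
 + a₁₁⊗(b₁₂+b₂₂)⊗c₁₁ + a₁₂⊗(b₁₁+b₁₂+b₂₁+b₂₂)⊗(c₁₁+c₂₁+c₂₂) + (a₁₂+a₂₁)⊗(b₁₁+b₁₂)⊗c₂₂
 + (a₁₂+a₂₂)⊗(b₂₁+b₂₂)⊗(c₂₁+c₂₂) + (a₁₁+a₁₂)⊗(b₁₁+b₁₂+b₂₂)⊗(c₁₁+c₂₁)`,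
"This scheme has no neighbors and thus forms a connected component of its own. We do not know
whether the `(2,2,2)`-flip graph of rank at most 8 has any further components."

What is PROVED here (all by kernel evaluation over `ZMod 2` plus one general lemma):
* `KM222Isolated.sum_eq` — the eight printed rank-one tensors sum to `⟨2,2,2⟩` over `ℤ₂` (KM's
  convention `M = Σ a_{ij} ⊗ b_{jk} ⊗ c_{ki}` read into the tree's slots: `u` = the `a`-factor on
  positions `(i,j)`, `v` = the `b`-factor on `(j,k)`, `w (i,k)` = the coefficient of `c_{k,i}`);
* `KM222Isolated.pairwise_ne` — no two of the eight terms share a factor in any slot (over `ℤ₂`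
  "sharing a factor up to a scalar" is equality), so NO FLIP (KM Def. 4: two elements `A⊗B⊗Γ`,
  `A⊗B'⊗Γ'` with a common factor) applies to the scheme;
* `KM222Isolated.not_reducible` — the scheme is NOT reducible in the sense of KM Def. 2 (all six
  cases, `FlipGraph.Reducible`), via
* `Reducible.exists_eq_factor_of_two` — over the field with two elements, a reducible family of
  non-zero rank-one tensors has two members with EQUAL factors in some slot (Def. 2 (1)
  `dim⟨X^{(i)}⟩_{i∈I} = 1` forces all `X^{(i)}`, `i ∈ I`, to be the unique non-zero vector of that
  line, and Def. 2 (2) forces `|I| ≥ 2` since a single non-zero vector is independent). This is the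
  criterion the flip-graph search codes use to test Def. 2 over `ℤ₂` (a consequence of Def. 2, not a
  statement printed in KM).
Together: the printed scheme has neither flips nor reductions — "no neighbors" — as printed.
(That it is not equivalent to a vertex of the 272-vertex component, and any exhaustive answer to
KM's question, are NOT formalised here.)
HONEST FRAMING: a finite kernel fact about one printed 8-term scheme over `ℤ₂`; no claim about ranks
over other fields.

## References

* M. Kauers, J. Moosbauer, *Flip Graphs for Matrix Multiplication*, ISSAC 2023, 381–388,
  doi:10.1145/3597066.3597120, arXiv:2212.01175: §4 (the `(2,2,2)`-flip graph over `ℤ₂`; the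
  displayed isolated scheme), §2 Def. 2, §3 Def. 4. [KauersMoosbauer2022FlipGraphs]
-/

namespace Literature.Computability.AlgebraicComplexity

namespace FlipGraph

open Finset Module

/-! ## Over `ℤ₂`: reducible ⇒ two terms with an equal factor -/

section TwoElementField

variable {K : Type*} [Field K]

/-- Over the field with two elements, two non-zero vectors in a set whose span is a line are equal
(the line has exactly one non-zero vector). [folklore] -/
private theorem eq_of_finrank_span_eq_one (hK : ∀ x : K, x = 0 ∨ x = 1) {V : Type*}
    [AddCommGroup V] [Module K V] {S : Set V} (h1 : finrank K (Submodule.span K S) = 1) {x y : V}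
    (hx : x ∈ S) (hy : y ∈ S) (hx0 : x ≠ 0) (hy0 : y ≠ 0) : x = y := by
  have hx' : (⟨x, Submodule.subset_span hx⟩ : Submodule.span K S) ≠ 0 := by
    intro h
    exact hx0 (by simpa using congrArg Subtype.val h)
  obtain ⟨c, hc⟩ := (finrank_eq_one_iff_of_nonzero' _ hx').mp h1 ⟨y, Submodule.subset_span hy⟩
  have hc' : c • x = y := by simpa using congrArg Subtype.val hc
  rcases hK c with rfl | rfl
  · rw [zero_smul] at hc'
    exact absurd hc'.symm hy0
  · rwa [one_smul] at hc'

/-- A linearly dependent finite subfamily of non-zero vectors has two distinct indices.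
[folklore] -/
private theorem exists_ne_of_not_linearIndepOn {V : Type*} [AddCommGroup V] [Module K V] {σ : Type*}
    {f : σ → V} {I : Finset σ} (h : ¬ LinearIndepOn K f (I : Set σ)) (h0 : ∀ i ∈ I, f i ≠ 0) :
    ∃ i ∈ I, ∃ j ∈ I, i ≠ j := by
  rw [not_linearIndepOn_finset_iff] at h
  obtain ⟨g, hg, t, ht, hgt⟩ := h
  by_contra hne
  push Not at hne
  have hI : ∑ i ∈ I, g i • f i = g t • f t :=
    Finset.sum_eq_single_of_mem t ht fun j hj hjt => absurd (hne j hj t ht) hjt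
  rw [hI] at hg
  exact smul_ne_zero hgt (h0 t ht) hg

/-- A rank-one tensor `a ⊗ b ⊗ c` is non-zero only if each factor is. [folklore] -/
private theorem factors_ne_zero {ι κ μ : Type*} {a : ι → K} {b : κ → K} {c : μ → K}
    (h : triad a b c ≠ 0) : a ≠ 0 ∧ b ≠ 0 ∧ c ≠ 0 := by
  refine ⟨?_, ?_, ?_⟩ <;> rintro rfl <;> apply h <;> funext x y z <;>
    simp only [triad_apply, Pi.zero_apply, zero_mul, mul_zero]

variable {ι κ μ σ : Type*}

/-- **KM Def. 2 over the two-element field: a reducible family has two members with an equal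
factor.** If every scalar is `0` or `1` (`K = ℤ₂`), and a family `(w s ⊗ u s ⊗ v s)_s` of non-zero
rank-one tensors is reducible (Def. 2, any of the six cases), then there are indices `i ≠ j` with
`w i = w j` or `u i = u j` or `v i = v j`: Def. 2 (1) makes all `X^{(i)}`, `i ∈ I`, equal to the
unique non-zero vector of the line `⟨X^{(i)}⟩_{i∈I}`, and Def. 2 (2) needs `|I| ≥ 2` because one
non-zero vector is independent. (A consequence of Def. 2 for `K = ℤ₂`, the ground field of KM §4–5;
it is the test for reducibility used by flip-graph searches over `ℤ₂`.)
[cite: KauersMoosbauer2022FlipGraphs, Def. 2 (with §3–4: ground field ℤ₂)] -/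
theorem Reducible.exists_eq_factor_of_two (hK : ∀ x : K, x = 0 ∨ x = 1) {w : σ → ι → K}
    {u : σ → κ → K} {v : σ → μ → K} (hred : Reducible w u v)
    (h0 : ∀ s, triad (w s) (u s) (v s) ≠ 0) :
    ∃ i j : σ, i ≠ j ∧ (w i = w j ∨ u i = u j ∨ v i = v j) := by
  have hw : ∀ s, w s ≠ 0 := fun s => (factors_ne_zero (h0 s)).1
  have hu : ∀ s, u s ≠ 0 := fun s => (factors_ne_zero (h0 s)).2.1
  have hv : ∀ s, v s ≠ 0 := fun s => (factors_ne_zero (h0 s)).2.2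
  obtain ⟨I, -, hI⟩ := hred
  rcases hI with ⟨h1, h2⟩ | ⟨h1, h2⟩ | ⟨h1, h2⟩
  · have hij : ∃ i ∈ I, ∃ j ∈ I, i ≠ j := by
      rcases h2 with h2 | h2
      · exact exists_ne_of_not_linearIndepOn h2 fun i _ => hu i
      · exact exists_ne_of_not_linearIndepOn h2 fun i _ => hv i
    obtain ⟨i, hi, j, hj, hne⟩ := hij
    exact ⟨i, j, hne, Or.inl (eq_of_finrank_span_eq_one hK h1
      (Set.mem_image_of_mem w (Finset.mem_coe.mpr hi))
      (Set.mem_image_of_mem w (Finset.mem_coe.mpr hj)) (hw i) (hw j))⟩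
  · have hij : ∃ i ∈ I, ∃ j ∈ I, i ≠ j := by
      rcases h2 with h2 | h2
      · exact exists_ne_of_not_linearIndepOn h2 fun i _ => hw i
      · exact exists_ne_of_not_linearIndepOn h2 fun i _ => hv i
    obtain ⟨i, hi, j, hj, hne⟩ := hij
    exact ⟨i, j, hne, Or.inr (Or.inl (eq_of_finrank_span_eq_one hK h1
      (Set.mem_image_of_mem u (Finset.mem_coe.mpr hi))
      (Set.mem_image_of_mem u (Finset.mem_coe.mpr hj)) (hu i) (hu j)))⟩
  · have hij : ∃ i ∈ I, ∃ j ∈ I, i ≠ j := by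
      rcases h2 with h2 | h2
      · exact exists_ne_of_not_linearIndepOn h2 fun i _ => hw i
      · exact exists_ne_of_not_linearIndepOn h2 fun i _ => hu i
    obtain ⟨i, hi, j, hj, hne⟩ := hij
    exact ⟨i, j, hne, Or.inr (Or.inr (eq_of_finrank_span_eq_one hK h1
      (Set.mem_image_of_mem v (Finset.mem_coe.mpr hi))
      (Set.mem_image_of_mem v (Finset.mem_coe.mpr hj)) (hv i) (hv j)))⟩

end TwoElementField

end FlipGraph

/-! ## The printed scheme -/

namespace KM222Isolated

open FlipGraph

/-- Slot-2 factors (`A`-factors on positions `(i,j)`, as `2 × 2` arrays) of the eight printed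
terms, in printed order: `a₁₁+a₂₂, a₂₂, a₂₁+a₂₂, a₁₁, a₁₂, a₁₂+a₂₁, a₁₂+a₂₂, a₁₁+a₁₂`.
[cite: KauersMoosbauer2022FlipGraphs, §4 (displayed isolated scheme)] -/
def tabU : Fin 8 → Fin 2 → Fin 2 → ZMod 2 :=
  ![![![1, 0], ![0, 1]], ![![0, 0], ![0, 1]], ![![0, 0], ![1, 1]], ![![1, 0], ![0, 0]],
    ![![0, 1], ![0, 0]], ![![0, 1], ![1, 0]], ![![0, 1], ![0, 1]], ![![1, 1], ![0, 0]]]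

/-- Slot-3 factors (`B`-factors on positions `(j,k)`): `b₁₁+b₂₂, b₁₁+b₂₁, b₁₁, b₁₂+b₂₂,
b₁₁+b₁₂+b₂₁+b₂₂, b₁₁+b₁₂, b₂₁+b₂₂, b₁₁+b₁₂+b₂₂`.
[cite: KauersMoosbauer2022FlipGraphs, §4 (displayed isolated scheme)] -/
def tabV : Fin 8 → Fin 2 → Fin 2 → ZMod 2 :=
  ![![![1, 0], ![0, 1]], ![![1, 0], ![1, 0]], ![![1, 0], ![0, 0]], ![![0, 1], ![0, 1]],
    ![![1, 1], ![1, 1]], ![![1, 1], ![0, 0]], ![![0, 0], ![1, 1]], ![![1, 1], ![0, 1]]]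

/-- Slot-1 factors (output positions `(i,k)`; entry `(i,k)` = printed coefficient of `c_{k,i}`):
`c₂₁, c₁₂+c₂₁+c₂₂, c₁₂+c₂₂, c₁₁, c₁₁+c₂₁+c₂₂, c₂₂, c₂₁+c₂₂, c₁₁+c₂₁`, transposed.
[cite: KauersMoosbauer2022FlipGraphs, §4 (displayed isolated scheme), Def. 1 (`c_{k,i}`)] -/
def tabW : Fin 8 → Fin 2 → Fin 2 → ZMod 2 :=
  ![![![0, 1], ![0, 0]], ![![0, 1], ![1, 1]], ![![0, 0], ![1, 1]], ![![1, 0], ![0, 0]],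
    ![![1, 1], ![0, 1]], ![![0, 0], ![0, 1]], ![![0, 1], ![0, 1]], ![![1, 1], ![0, 0]]]

/-- The `A`-factor of term `s` as a function on `Fin 2 × Fin 2`.
[cite: KauersMoosbauer2022FlipGraphs, §4] -/
def u (s : Fin 8) (p : Fin 2 × Fin 2) : ZMod 2 := tabU s p.1 p.2

/-- The `B`-factor of term `s`. [cite: KauersMoosbauer2022FlipGraphs, §4] -/
def v (s : Fin 8) (p : Fin 2 × Fin 2) : ZMod 2 := tabV s p.1 p.2

/-- The output factor of term `s` (tree slot 1). [cite: KauersMoosbauer2022FlipGraphs, §4] -/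
def w (s : Fin 8) (p : Fin 2 × Fin 2) : ZMod 2 := tabW s p.1 p.2

/-- **The printed identity:** the eight rank-one tensors sum to `⟨2,2,2⟩` over `ℤ₂` (all `64` Brent
equations, by kernel evaluation).
[cite: KauersMoosbauer2022FlipGraphs, §4 (displayed isolated scheme)] -/
theorem sum_eq : ∑ s, triad (w s) (u s) (v s) = matMulTensor (ZMod 2) 2 2 2 := by
  funext a b c
  rw [Finset.sum_apply, Finset.sum_apply, Finset.sum_apply]
  revert a b c
  decide

/-- Hence `R_{ℤ₂}(⟨2,2,2⟩) ≤ 8` is witnessed by this scheme (the bound itself is trivial; recorded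
only to tie the object to `tensorRank`). [cite: KauersMoosbauer2022FlipGraphs, §4] -/
theorem tensorRank_le_eight : tensorRank (matMulTensor (ZMod 2) 2 2 2) ≤ 8 := by
  simpa using tensorRank_le_card_of_eq_sum w u v sum_eq.symm

/-- Every printed term is a (non-zero) rank-one tensor (KM Def. 1).
[cite: KauersMoosbauer2022FlipGraphs, §4, Def. 1] -/
theorem triad_ne_zero : ∀ s : Fin 8, triad (w s) (u s) (v s) ≠ 0 := by
  decide

/-- **No two terms share a factor** (in any of the three slots; over `ℤ₂` proportional = equal):
no flip (KM Def. 4) applies to the printed scheme.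
[cite: KauersMoosbauer2022FlipGraphs, §4 ("has no neighbors"), Def. 4] -/
theorem pairwise_ne : ∀ i j : Fin 8, i ≠ j → w i ≠ w j ∧ u i ≠ u j ∧ v i ≠ v j := by
  decide

/-- **The printed scheme is irreducible** (KM Def. 2, all six cases): no reduction applies either —
"This scheme has no neighbors and thus forms a connected component of its own."
[cite: KauersMoosbauer2022FlipGraphs, §4 ("has no neighbors"), Def. 2] -/
theorem not_reducible : ¬ Reducible w u v := by
  intro h
  obtain ⟨i, j, hne, hsh⟩ := h.exists_eq_factor_of_two (by decide) triad_ne_zero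
  obtain ⟨h₁, h₂, h₃⟩ := pairwise_ne i j hne
  rcases hsh with e | e | e
  · exact h₁ e
  · exact h₂ e
  · exact h₃ e

end KM222Isolated

end Literature.Computability.AlgebraicComplexity
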